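import Mathlib
import HarnessLib
import Summits.HubbardSuperconductivity.HubbardSuperconductivity.Theorems.KLProgrammeH10TwoPointLimitPerturbedCountPairsExists
import Summits.HubbardSuperconductivity.HubbardSuperconductivity.Theorems.KLProgrammeCountPairsOffsetNondegP

/-!
# Route `KLProgramme` — crux K1 `H10TwoPointLimit` (stmt-HubbardSuperconductivity-19938):
# the two-dimensional sector count ON THE PERTURBED FERMI CURVE — small constants and the uniform theorem (row (F) on the moving curve, all scales)

Final step of the port HOME/prover-p4/PORT-NOTE.md (G-002 closer (i), architecture (β)). `count_pairs_perturbed_exists` (file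
`…PerturbedCountPairsExists.lean`) gives the count for constants satisfying five explicit smallness conditions in the perturbation sizes
`κ₀, κ₁, κ₂`. Here:

* `pcOdd_zero`, `pcEven_zero`, `pcDiag_zero`, `pcE4_zero` — at `κ = 0` the four losses ARE the free losses of the lineage's
  `exists_small_constants_offset` with `A₂` replaced by `A_E(0)` (closed forms by `ring`);
* `continuousAt_pc*` — the losses are continuous in the perturbation size at `κ = 0` (rational functions, denominators `Dt_min - κ`);
* `exists_small_constants_perturbed` — hence for every `BandBounds` bundle and margin `m₀` there are `κ > 0` and `τ, λ, η₀ ≤ m₀, η₁ > 0`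
  satisfying all five conditions with `κ₀ = κ₁ = κ₂ = κ` (free constants from the lineage for the bundle with `A₂ ↦ max(A₂, 2A_E(0))`, halved,
  then a neighbourhood of `κ = 0`);
* `countPairs_perturbed` — **the route item `CountPairsOffset` (S5 = DECOMP App. F Lemma F.1, BGM (2.76)/(2.80)) ON THE MOVING CURVE**: on every
  level range `[a, b] ⊂ (-4, 0)` with margin `η₀` and tolerance constant `C_δ` there are `κ > 0` and `K_p` such that for EVERY `C²` even perturbation
  `δ` of `ε₀` with `|δ|, ‖Dδ‖, ‖D²δ‖ ≤ κ` (BGM's scale-`h` dispersion `E_h - ε₀`, the `C₄ᵥ` frames of K3 child 3), every interior `μ`, every root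
  selection `u` of `{ε₀ + δ = μ}`, EVERY offset `P ∈ ℝ²` and every isotropic angular grid (`N = 2π/w` cells, `w = π/2^J ≤ 1`, `C_δ w ≤ η₀/2`):
  `#{(i, j) : |ε₂(P + p_E(θ_i) + p_E(θ_j)) + δ(P + p_E(θ_i) + p_E(θ_j)) - μ| ≤ C_δ w} ≤ K_p (J + 2 + log N)/w` — uniformly in `δ, μ, u, P`.
  At `δ = 0`, `u = u_μ` this is `CountPairsOffset` (`hfunE_zero_band`); for the scale-`h` curves of BGM 2006 Thm 2.1 / App. A3 it is the sector
  count (2.76)/(2.80) at ALL scales `h` with `|E_h - ε₀|_{C²} ≤ κ` (input (F) of HOME/prover-p4/SECTOR-COUNTING-INTERFACE.md, GAP-LEDGER G-002).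

Everything is PROVED; no definitions. References: BGM 2006 Lemma 3.1 / (2.76) / (2.80) / App. A2–A3 [cite: BenfattoGiulianiMastropietro2006];
HOME/prover-p4/COUNTING-NOTE.md, PORT-NOTE.md.
-/

noncomputable section

namespace Summit.HubbardSuperconductivity.HubbardSuperconductivity.Theorems.PerturbedFermiCurve

set_option linter.dupNamespace false -- summit = problem name (single-conjunct summit), D-0017

open Real Set Filter Topology
open Literature.MathematicalPhysics.QuantumLattice Literature.MathematicalPhysics.QuantumLattice.BandSectorCounting
open Summit.HubbardSuperconductivity.HubbardSuperconductivity.Theorems.CountPairsOffset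

variable {a b : ℝ}

/-! ## §1 The losses at `κ = 0` -/

/-- The covering tolerance at `κ = 0`. [folklore] -/
theorem pcE4_zero (B : BandBounds a b) (lam η₀ : ℝ) :
    pcE4 B 0 0 lam η₀ = lam / 2 + 2 * B.smax * (η₀ / B.Dtmin) := by
  unfold pcE4 pcSE pcCV; ring

/-- The Cooper-range loss at `κ = 0`. [folklore] -/
theorem pcOdd_zero (B : BandBounds a b) (lam η₀ τ : ℝ) :
    pcOdd B 0 0 0 lam η₀ τ = 2 * pcAE B 0 0 * (η₀ / B.Dtmin + B.smax * (B.Cg * (lam / 2 + 2 * B.smax * (η₀ / B.Dtmin)) + τ)) := by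
  unfold pcOdd pcE4 pcSE pcCV; ring

/-- The fold loss at `κ = 0`. [folklore] -/
theorem pcEven_zero (B : BandBounds a b) (lam η₀ τ : ℝ) :
    pcEven B 0 0 0 lam η₀ τ =
      2 * pcAE B 0 0 * (η₀ / B.Dtmin + B.smax * (B.Cg * (lam + pcAE B 0 0 * τ + 2 * B.smax * (η₀ / B.Dtmin)) + τ / 2)) := by
  unfold pcEven pcE4 pcSE pcCV; ring

/-- The diagonal loss at `κ = 0`. [folklore] -/
theorem pcDiag_zero (B : BandBounds a b) (η₀ η₁ : ℝ) :
    pcDiag B 0 0 0 η₀ η₁ = (16 * B.smax ^ 2 + 8 * pcAE B 0 0) * (η₀ / B.Dtmin + B.smax * (B.Cg * (η₁ / 4 + 2 * B.smax * (η₀ / B.Dtmin)))) := by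
  unfold pcDiag pcE4 pcSE pcCV; ring

/-! ## §2 Continuity of the losses in the perturbation size at `κ = 0` -/

/-- `κ ↦ C_V(κ)` is continuous at `0`. [folklore] -/
theorem continuousAt_pcCV (B : BandBounds a b) : ContinuousAt (fun κ : ℝ => pcCV B κ) 0 := by
  have hDt := B.Dtmin_pos
  unfold pcCV
  exact ((continuousAt_id.mul continuousAt_const).div (continuousAt_const.sub continuousAt_id) (by simp [hDt.ne']))

/-- `κ ↦ S_E(κ)` is continuous at `0`. [folklore] -/
theorem continuousAt_pcSE (B : BandBounds a b) : ContinuousAt (fun κ : ℝ => pcSE B κ) 0 := by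
  unfold pcSE; exact continuousAt_const.add (continuousAt_pcCV B)

/-- `κ ↦ U₁(κ)` is continuous at `0`. [folklore] -/
theorem continuousAt_pcU1 (B : BandBounds a b) : ContinuousAt (fun κ : ℝ => pcU1 B κ) 0 := by
  have hDt := B.Dtmin_pos
  unfold pcU1
  exact (((continuousAt_const.add continuousAt_id).mul continuousAt_const).div (continuousAt_const.sub continuousAt_id)
    (by simp [hDt.ne']))

/-- `κ ↦ A_E(κ, κ)` is continuous at `0`. [folklore] -/
theorem continuousAt_pcAE (B : BandBounds a b) : ContinuousAt (fun κ : ℝ => pcAE B κ κ) 0 := by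
  have hDt := B.Dtmin_pos
  have hSE := continuousAt_pcSE B
  have hU1 := continuousAt_pcU1 B
  have hU2 : ContinuousAt (fun κ : ℝ => pcU2 B κ κ) 0 := by
    unfold pcU2
    refine ContinuousAt.div ?_ (continuousAt_const.sub continuousAt_id) (by simp [hDt.ne'])
    exact (((continuousAt_const.add continuousAt_id).mul (hSE.pow 2)).add
      ((continuousAt_const.add (continuousAt_const.mul continuousAt_id)).mul hU1)).add
      ((continuousAt_const.add continuousAt_id).mul continuousAt_const)
  unfold pcAE
  exact (hU2.add (continuousAt_const.mul hU1)).add continuousAt_const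

/-- `κ ↦ ε₄(κ, κ; λ, η₀)` is continuous at `0`. [folklore] -/
theorem continuousAt_pcE4 (B : BandBounds a b) (lam η₀ : ℝ) : ContinuousAt (fun κ : ℝ => pcE4 B κ κ lam η₀) 0 := by
  have hSE := continuousAt_pcSE B
  have hCV := continuousAt_pcCV B
  unfold pcE4
  exact (((continuousAt_const.add ((continuousAt_id.mul hSE).div_const 2)).add (continuousAt_const.mul hCV)).add
    continuousAt_const).add (continuousAt_const.mul ((continuousAt_const.mul continuousAt_id).div_const _))

/-- The covering tolerance with a `κ`-dependent `λ` (as inside `pcEven`) is continuous at `0`. [folklore] -/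
theorem continuousAt_pcE4_comp (B : BandBounds a b) {f : ℝ → ℝ} (hf : ContinuousAt f 0) (η₀ : ℝ) :
    ContinuousAt (fun κ : ℝ => pcE4 B κ κ (f κ) η₀) 0 := by
  have hSE := continuousAt_pcSE B
  have hCV := continuousAt_pcCV B
  unfold pcE4
  exact ((((hf.div_const 2).add ((continuousAt_id.mul hSE).div_const 2)).add (continuousAt_const.mul hCV)).add
    continuousAt_const).add (continuousAt_const.mul ((continuousAt_const.mul continuousAt_id).div_const _))

/-- `κ ↦ pcOdd(κ, κ, κ; λ, η₀, τ)` is continuous at `0`. [folklore] -/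
theorem continuousAt_pcOdd (B : BandBounds a b) (lam η₀ τ : ℝ) : ContinuousAt (fun κ : ℝ => pcOdd B κ κ κ lam η₀ τ) 0 := by
  have hSE := continuousAt_pcSE B
  have hCV := continuousAt_pcCV B
  have hAE := continuousAt_pcAE B
  have hE4 := continuousAt_pcE4 B lam η₀
  unfold pcOdd
  exact ((((continuousAt_const.mul hCV).mul (hSE.add continuousAt_const)).add
      (((continuousAt_id.mul (hSE.pow 2)).add (continuousAt_id.mul hAE)).div_const 2)).add
    ((continuousAt_const.mul hAE).mul ((continuousAt_const.add ((continuousAt_const.mul continuousAt_id).div_const _)).add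
      (continuousAt_const.mul ((continuousAt_const.mul hE4).add continuousAt_const)))))

/-- `κ ↦ κ A_E(κ, κ)` is continuous at `0`. [folklore] -/
theorem continuousAt_mul_pcAE (B : BandBounds a b) : ContinuousAt (fun κ : ℝ => κ * pcAE B κ κ) 0 :=
  continuousAt_id.mul (continuousAt_pcAE B)

/-- `κ ↦ pcEven(κ, κ, κ; λ, η₀, τ)` is continuous at `0`. [folklore] -/
theorem continuousAt_pcEven (B : BandBounds a b) (lam η₀ τ : ℝ) : ContinuousAt (fun κ : ℝ => pcEven B κ κ κ lam η₀ τ) 0 := by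
  have hSE := continuousAt_pcSE B
  have hCV := continuousAt_pcCV B
  have hAE := continuousAt_pcAE B
  have hlam : ContinuousAt (fun κ : ℝ => 2 * lam + (4 + κ) * pcAE B κ κ * τ / 2) 0 :=
    continuousAt_const.add ((((continuousAt_const.add continuousAt_id).mul hAE).mul continuousAt_const).div_const 2)
  have hE4 := continuousAt_pcE4_comp B hlam η₀
  have hT1 : ContinuousAt (fun κ : ℝ => 4 * pcCV B κ * (pcSE B κ + B.smax)) 0 :=
    (continuousAt_const.mul hCV).mul (hSE.add continuousAt_const)
  have hT2 : ContinuousAt (fun κ : ℝ => (κ * pcSE B κ ^ 2 + κ * pcAE B κ κ) / 2) 0 :=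
    ((continuousAt_id.mul (hSE.pow 2)).add (continuousAt_id.mul hAE)).div_const 2
  have hIn : ContinuousAt (fun κ : ℝ => η₀ / B.Dtmin + 2 * κ / B.Dtmin +
      B.smax * (B.Cg * pcE4 B κ κ (2 * lam + (4 + κ) * pcAE B κ κ * τ / 2) η₀ + τ / 2)) 0 :=
    (continuousAt_const.add ((continuousAt_const.mul continuousAt_id).div_const _)).add
      (continuousAt_const.mul ((continuousAt_const.mul hE4).add continuousAt_const))
  have hT3 : ContinuousAt (fun κ : ℝ => 2 * pcAE B κ κ * (η₀ / B.Dtmin + 2 * κ / B.Dtmin +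
      B.smax * (B.Cg * pcE4 B κ κ (2 * lam + (4 + κ) * pcAE B κ κ * τ / 2) η₀ + τ / 2))) 0 := (continuousAt_const.mul hAE).mul hIn
  have hT4 : ContinuousAt (fun κ : ℝ => κ * pcAE B κ κ / 2) 0 := (continuousAt_id.mul hAE).div_const 2
  unfold pcEven
  exact ((hT1.add hT2).add hT3).add hT4

/-- `κ ↦ pcDiag(κ, κ, κ; η₀, η₁)` is continuous at `0`. [folklore] -/
theorem continuousAt_pcDiag (B : BandBounds a b) (η₀ η₁ : ℝ) : ContinuousAt (fun κ : ℝ => pcDiag B κ κ κ η₀ η₁) 0 := by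
  have hSE := continuousAt_pcSE B
  have hCV := continuousAt_pcCV B
  have hAE := continuousAt_pcAE B
  have hE4 := continuousAt_pcE4 B (η₁ / 2) η₀
  unfold pcDiag
  exact ((((continuousAt_const.mul hCV).mul (hSE.add continuousAt_const)).add
      (((continuousAt_const.mul (hSE.pow 2)).add (continuousAt_const.mul hAE)).mul
        ((continuousAt_const.add ((continuousAt_const.mul continuousAt_id).div_const _)).add
          (continuousAt_const.mul (continuousAt_const.mul hE4))))).add
    (continuousAt_const.mul (continuousAt_id.mul (hSE.pow 2)))).add (continuousAt_const.mul (continuousAt_id.mul hAE))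

/-! ## §3 The small constants -/

/-- **Choice of the small constants for the count on the perturbed curve**: given the uniform bounds `B` and a margin `m₀ > 0` there are a
perturbation size `κ > 0` (`κ < Dt_min`, `κ ≤ m₀`) and `τ, λ, η₀, η₁ > 0` (`η₀ ≤ m₀`, `τ < π`) satisfying the five smallness conditions of
`count_pairs_perturbed_exists` with `κ₀ = κ₁ = κ₂ = κ`. Proof: the lineage's free constants for the bundle `B` with `A₂ ↦ max(A₂, 2A_E(0))`,
halved, satisfy the conditions STRICTLY at `κ = 0`; continuity in `κ`. [folklore] -/
theorem exists_small_constants_perturbed (B : BandBounds a b) {m₀ : ℝ} (hm₀ : 0 < m₀) :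
    ∃ κ τ lam η₀ η₁ : ℝ, 0 < κ ∧ κ < B.Dtmin ∧ κ ≤ m₀ ∧ 0 < τ ∧ τ < π ∧ 0 < lam ∧ 0 < η₀ ∧ η₀ ≤ m₀ ∧ 0 < η₁ ∧
      2 * (B.Cg * pcE4 B κ κ lam η₀) ≤ τ ∧ pcOdd B κ κ κ (2 * lam) η₀ τ ≤ B.hmin / 2 ∧ κ * pcAE B κ κ ≤ B.hmin / 2 ∧
      pcEven B κ κ κ lam η₀ τ ≤ B.hmin / 2 ∧ pcDiag B κ κ κ η₀ η₁ ≤ 2 * B.hmin := by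
  have hs := B.smax_pos; have hh := B.hmin_pos; have hCg := B.Cg_pos; have hDt := B.Dtmin_pos
  obtain ⟨-, -, -, -, hAE0, -⟩ := pc_pos B le_rfl hDt le_rfl
  obtain ⟨A₀, hA₀⟩ : ∃ A₀ : ℝ, A₀ = pcAE B 0 0 := ⟨_, rfl⟩
  rw [← hA₀] at hAE0
  -- the free constants of the lineage for the bundle with the larger acceleration constant `max(A₂, 2A_E(0))`, then halved
  obtain ⟨A', τ, lam, η₀, η₁, hA', hτ, hτπ, hlam, hη₀, hη₀m, hη₁, c1, c2, c3, c4⟩ : ∃ A' τ lam η₀ η₁ : ℝ, 2 * A₀ ≤ A' ∧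
      0 < τ ∧ τ < π ∧ 0 < lam ∧ 0 < η₀ ∧ η₀ ≤ m₀ ∧ 0 < η₁ ∧
      2 * (B.Cg * (lam / 2 + 2 * B.smax * (η₀ / B.Dtmin))) ≤ τ ∧
      4 * A' * (η₀ / B.Dtmin + B.smax * (B.Cg * (lam + 2 * B.smax * (η₀ / B.Dtmin)) + τ)) ≤ B.hmin ∧
      2 * A' * (η₀ / B.Dtmin + B.smax * (B.Cg * (lam + A' * τ + 2 * B.smax * (η₀ / B.Dtmin)) + τ / 2)) ≤ B.hmin / 2 ∧
      (16 * B.smax ^ 2 + 8 * A') * (η₀ / B.Dtmin + B.smax * (B.Cg * (η₁ / 4 + 2 * B.smax * (η₀ / B.Dtmin)))) ≤ 2 * B.hmin := by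
    let B' : BandBounds a b :=
      { B with
        A2 := max B.A2 (2 * A₀)
        A2_pos := lt_max_of_lt_left B.A2_pos
        abs_AX_le := fun μ hμ θ => (B.abs_AX_le μ hμ θ).trans (le_max_left _ _)
        abs_AY_le := fun μ hμ θ => (B.abs_AY_le μ hμ θ).trans (le_max_left _ _) }
    obtain ⟨τ, lam, η₀, η₁, hτ, hτπ, hlam, hη₀, hη₀m, hη₁, c1, c2, c3, c4⟩ := exists_small_constants_offset B' hm₀
    exact ⟨max B.A2 (2 * A₀), τ, lam, η₀, η₁, le_max_right _ _, hτ, hτπ, hlam, hη₀, hη₀m, hη₁, c1, c2, c3, c4⟩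
  have hA'0 : 0 ≤ A' := le_trans (by linarith) hA'
  -- nonnegativity of the monomials
  have m1 : 0 ≤ η₀ / B.Dtmin := by positivity
  have m2 : 0 < B.Cg * lam := by positivity
  have m3 : 0 ≤ B.Cg * (B.smax * (η₀ / B.Dtmin)) := by positivity
  have m4 : 0 ≤ B.smax * (B.Cg * lam) := by positivity
  have m5 : 0 ≤ B.smax * (B.Cg * (B.smax * (η₀ / B.Dtmin))) := by positivity
  have m6 : 0 ≤ B.smax * τ := by positivity
  have m7 : 0 ≤ B.smax * (B.Cg * η₁) := by positivity
  have m8 : 0 ≤ B.smax * (B.Cg * (A₀ * τ)) := by positivity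
  have m9 : A₀ * τ ≤ A' * τ := mul_le_mul_of_nonneg_right (by linarith) hτ.le
  have ediv : η₀ / 2 / B.Dtmin = η₀ / B.Dtmin / 2 := by ring
  -- the five conditions hold STRICTLY at `κ = 0` for `(τ, λ/2, η₀/2, η₁/2)`
  have s1 : 2 * (B.Cg * pcE4 B 0 0 (lam / 2) (η₀ / 2)) < τ := by
    rw [pcE4_zero, ediv]; linarith
  have s2 : pcOdd B 0 0 0 (2 * (lam / 2)) (η₀ / 2) τ < B.hmin / 2 := by
    rw [pcOdd_zero, ← hA₀, ediv]
    have hY : η₀ / B.Dtmin / 2 + B.smax * (B.Cg * (2 * (lam / 2) / 2 + 2 * B.smax * (η₀ / B.Dtmin / 2)) + τ) ≤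
        η₀ / B.Dtmin + B.smax * (B.Cg * (lam + 2 * B.smax * (η₀ / B.Dtmin)) + τ) := by linarith
    have hYpos : 0 ≤ η₀ / B.Dtmin / 2 + B.smax * (B.Cg * (2 * (lam / 2) / 2 + 2 * B.smax * (η₀ / B.Dtmin / 2)) + τ) := by
      positivity
    have h1 : 2 * A₀ * (η₀ / B.Dtmin / 2 + B.smax * (B.Cg * (2 * (lam / 2) / 2 + 2 * B.smax * (η₀ / B.Dtmin / 2)) + τ)) ≤
        A' * (η₀ / B.Dtmin + B.smax * (B.Cg * (lam + 2 * B.smax * (η₀ / B.Dtmin)) + τ)) :=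
      mul_le_mul hA' hY hYpos hA'0
    linarith
  have s3 : (0 : ℝ) * pcAE B 0 0 < B.hmin / 2 := by rw [zero_mul]; positivity
  have s4 : pcEven B 0 0 0 (lam / 2) (η₀ / 2) τ < B.hmin / 2 := by
    rw [pcEven_zero, ← hA₀, ediv]
    have hY : η₀ / B.Dtmin / 2 + B.smax * (B.Cg * (lam / 2 + A₀ * τ + 2 * B.smax * (η₀ / B.Dtmin / 2)) + τ / 2) ≤
        η₀ / B.Dtmin + B.smax * (B.Cg * (lam + A' * τ + 2 * B.smax * (η₀ / B.Dtmin)) + τ / 2) := by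
      have : B.smax * (B.Cg * (A₀ * τ)) ≤ B.smax * (B.Cg * (A' * τ)) :=
        mul_le_mul_of_nonneg_left (mul_le_mul_of_nonneg_left m9 hCg.le) hs.le
      linarith
    have hYpos : 0 ≤ η₀ / B.Dtmin / 2 + B.smax * (B.Cg * (lam / 2 + A₀ * τ + 2 * B.smax * (η₀ / B.Dtmin / 2)) + τ / 2) := by
      positivity
    have h1 : 2 * A₀ * (η₀ / B.Dtmin / 2 + B.smax * (B.Cg * (lam / 2 + A₀ * τ + 2 * B.smax * (η₀ / B.Dtmin / 2)) + τ / 2)) ≤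
        A' * (η₀ / B.Dtmin + B.smax * (B.Cg * (lam + A' * τ + 2 * B.smax * (η₀ / B.Dtmin)) + τ / 2)) :=
      mul_le_mul hA' hY hYpos hA'0
    linarith
  have s5 : pcDiag B 0 0 0 (η₀ / 2) (η₁ / 2) < 2 * B.hmin := by
    rw [pcDiag_zero, ← hA₀, ediv]
    have hW : η₀ / B.Dtmin / 2 + B.smax * (B.Cg * (η₁ / 2 / 4 + 2 * B.smax * (η₀ / B.Dtmin / 2))) ≤
        η₀ / B.Dtmin + B.smax * (B.Cg * (η₁ / 4 + 2 * B.smax * (η₀ / B.Dtmin))) := by linarith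
    have hWpos : 0 < η₀ / B.Dtmin / 2 + B.smax * (B.Cg * (η₁ / 2 / 4 + 2 * B.smax * (η₀ / B.Dtmin / 2))) := by positivity
    have hcoef : 16 * B.smax ^ 2 + 8 * A₀ < 16 * B.smax ^ 2 + 8 * A' := by linarith
    have hcoef0 : 0 ≤ 16 * B.smax ^ 2 + 8 * A' := by positivity
    calc (16 * B.smax ^ 2 + 8 * A₀) * (η₀ / B.Dtmin / 2 + B.smax * (B.Cg * (η₁ / 2 / 4 + 2 * B.smax * (η₀ / B.Dtmin / 2))))
        < (16 * B.smax ^ 2 + 8 * A') * (η₀ / B.Dtmin / 2 + B.smax * (B.Cg * (η₁ / 2 / 4 + 2 * B.smax * (η₀ / B.Dtmin / 2)))) :=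
          mul_lt_mul_of_pos_right hcoef hWpos
      _ ≤ (16 * B.smax ^ 2 + 8 * A') * (η₀ / B.Dtmin + B.smax * (B.Cg * (η₁ / 4 + 2 * B.smax * (η₀ / B.Dtmin)))) :=
          mul_le_mul_of_nonneg_left hW hcoef0
      _ ≤ 2 * B.hmin := c4
  -- continuity in `κ` at `0`
  have e1 := (continuousAt_const.mul (continuousAt_const.mul (continuousAt_pcE4 B (lam / 2) (η₀ / 2)))).eventually_lt
    continuousAt_const s1
  have e2 := (continuousAt_pcOdd B (2 * (lam / 2)) (η₀ / 2) τ).eventually_lt continuousAt_const s2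
  have e3 := (continuousAt_mul_pcAE B).eventually_lt continuousAt_const s3
  have e4 := (continuousAt_pcEven B (lam / 2) (η₀ / 2) τ).eventually_lt continuousAt_const s4
  have e5 := (continuousAt_pcDiag B (η₀ / 2) (η₁ / 2)).eventually_lt continuousAt_const s5
  obtain ⟨ε, hε, hball⟩ := Metric.eventually_nhds_iff.1 (e1.and (e2.and (e3.and (e4.and e5))))
  set κ := min (ε / 2) (min m₀ (B.Dtmin / 2)) with hκ
  have hκ0 : 0 < κ := lt_min (by linarith) (lt_min hm₀ (by linarith))
  have hκε : κ ≤ ε / 2 := min_le_left _ _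
  have hκm : κ ≤ m₀ := (min_le_right _ _).trans (min_le_left _ _)
  have hκD : κ ≤ B.Dtmin / 2 := (min_le_right _ _).trans (min_le_right _ _)
  have hdist : dist κ 0 < ε := by rw [dist_zero_right, Real.norm_eq_abs, abs_of_pos hκ0]; linarith
  obtain ⟨d1, d2, d3, d4, d5⟩ := hball hdist
  refine ⟨κ, τ, lam / 2, η₀ / 2, η₁ / 2, hκ0, by linarith, hκm, hτ, hτπ, by linarith, by linarith, by linarith, by linarith,
    d1.le, d2.le, d3.le, d4.le, d5.le⟩

/-! ## §4 The uniform theorem -/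

/-- **The sector count `CountPairsOffset` on the perturbed Fermi curve, uniformly over the perturbation class** (DECOMP App. F Lemma F.1 /
BGM (2.76)/(2.80) on the moving curve `{ε₀ + δ = μ}`; input (F) of Paper 1's Thm 2.1 re-run at ALL scales; GAP-LEDGER G-002 closer (i)).
For the FREE curve (`δ = 0`, `u = u_μ`) this is the landed `CountPairsOffset_proof` (`hfunE_zero_band`); here `δ` ranges over all `C²` even
perturbations with `|δ|, ‖Dδ‖, ‖D²δ‖ ≤ κ` on `ℝ²` and `u` over all root selections, with ONE `κ` and ONE `K_p` per level range, margin and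
tolerance constant. [cite: BenfattoGiulianiMastropietro2006, Lemma 3.1 / (2.76) / (2.80) / App. A3] -/
theorem countPairs_perturbed :
    ∀ a b : ℝ, -4 < a → a ≤ b → b < 0 → ∀ η₀ Cδ : ℝ, 0 < η₀ → 0 < Cδ →
      ∃ κ : ℝ, 0 < κ ∧ ∃ Kp : ℝ, 0 < Kp ∧
        ∀ δ : (Fin 2 → ℝ) → ℝ, ContDiff ℝ 2 δ → (∀ k, δ (-k) = δ k) →
          (∀ k : Fin 2 → ℝ, |δ k| ≤ κ) → (∀ k : Fin 2 → ℝ, ‖fderiv ℝ δ k‖ ≤ κ) → (∀ k : Fin 2 → ℝ, ‖fderiv ℝ (fderiv ℝ δ) k‖ ≤ κ) →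
        ∀ μ : ℝ, μ ∈ Set.Icc a b → a ≤ μ - η₀ → μ + η₀ ≤ b →
        ∀ u : ℝ → ℝ, (∀ θ, IsBandFermiRadius (μ - δ (u θ • dir θ)) θ (u θ)) →
        ∀ (P : ℝ × ℝ) (w : ℝ) (N Nh J : ℕ), 0 < w → w ≤ 1 → (N : ℝ) * w = 2 * Real.pi → (Nh : ℝ) * w = Real.pi → N = 2 * Nh →
          (2 : ℝ) ^ J * w = Real.pi → Cδ * w ≤ η₀ / 2 →
          ((((Finset.range N ×ˢ Finset.range N).filter fun p : ℕ × ℕ =>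
              |hfunE δ u μ P (w / 2 + p.1 * w) (w / 2 + p.2 * w)| ≤ Cδ * w).card : ℝ)) ≤ Kp * ((J : ℝ) + 2 + Real.log N) / w := by
  intro a b ha hab hb η₀ Cδ hη₀ hCδ
  obtain ⟨B, -⟩ : ∃ B : BandBounds a b, B = bandBounds ha hab hb := ⟨_, rfl⟩
  obtain ⟨κ, τ, lam, η₀', η₁, hκ, hκD, hκm, hτ, hτπ, hlam, hη₀', hη₀'m, hη₁, c1, c2, c3, c4, c5⟩ :=
    exists_small_constants_perturbed B (m₀ := η₀ / 2) (by positivity)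
  obtain ⟨Kp, hKp, hcount⟩ := count_pairs_perturbed_exists B (κ₀ := κ) (κ₁ := κ) (κ₂ := κ) hκ.le hκD hκ.le hCδ hτ hτπ hlam hη₀' hη₁
    c1 c2 c3 c4 c5
  have hπ := Real.pi_pos
  obtain ⟨K₁, hK₁⟩ : ∃ K₁ : ℝ, K₁ = (4 * π * Cδ / η₀') * (2 * π) := ⟨_, rfl⟩
  have hK₁0 : 0 < K₁ := by rw [hK₁]; positivity
  refine ⟨κ, hκ, Kp + K₁, by positivity, ?_⟩
  intro δ hδs heven hδ hκ' hκ₂ μ hμ hlo hhi u hu P w N Nh J hw hw1 hN hNh hNN hJ hδw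
  have hN0 : (0 : ℝ) < N := by
    have : (0:ℝ) < N * w := by rw [hN]; positivity
    exact pos_of_mul_pos_left this hw.le
  have hNpos : 0 < N := Nat.pos_of_ne_zero (fun h0 => by rw [h0] at hN0; simp at hN0)
  have hN1 : (1 : ℝ) ≤ N := by exact_mod_cast hNpos
  have hlog : 0 ≤ Real.log N := Real.log_nonneg hN1
  have hJ0 : (0 : ℝ) ≤ J := by positivity
  have hL1 : 1 ≤ (J : ℝ) + 2 + Real.log N := by linarith
  have hNw : (N : ℝ) = 2 * π / w := by field_simp; linarith only [hN]
  by_cases hsmallw : Cδ * w ≤ η₀' / 2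
  · -- the main case: the two-dimensional count applies
    have hlo' : a ≤ μ - κ - η₀' := by linarith
    have hhi' : μ + κ + η₀' ≤ b := by linarith
    have h := hcount δ hδs heven hδ hκ' hκ₂ μ hlo' hhi' u hu P w N Nh J hw hw1 hN hNh hNN hJ hsmallw
    have hK₁' : 0 ≤ K₁ * ((J : ℝ) + 2 + Real.log N) / w := by positivity
    have e : (Kp + K₁) * ((J : ℝ) + 2 + Real.log N) / w =
        Kp * ((J : ℝ) + 2 + Real.log N) / w + K₁ * ((J : ℝ) + 2 + Real.log N) / w := by ring
    rw [e]
    exact h.trans (le_add_of_nonneg_right hK₁')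
  · -- coarse grids: the trivial bound `N² ≤ K₁/w`
    push Not at hsmallw
    have hcard : ((((Finset.range N ×ˢ Finset.range N).filter fun p : ℕ × ℕ =>
        |hfunE δ u μ P (w / 2 + p.1 * w) (w / 2 + p.2 * w)| ≤ Cδ * w).card : ℝ)) ≤ (N : ℝ) * N := by
      have h1 := Finset.card_filter_le (Finset.range N ×ˢ Finset.range N) (fun p : ℕ × ℕ =>
        |hfunE δ u μ P (w / 2 + p.1 * w) (w / 2 + p.2 * w)| ≤ Cδ * w)
      rw [Finset.card_product, Finset.card_range] at h1
      exact_mod_cast h1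
    have hNN' : (N : ℝ) * N ≤ K₁ / w := by
      have hN2 : (N : ℝ) ≤ 4 * π * Cδ / η₀' := by
        rw [hNw, div_le_div_iff₀ hw hη₀']
        nlinarith [hsmallw, hπ]
      calc (N : ℝ) * N ≤ (4 * π * Cδ / η₀') * (2 * π / w) := by
            rw [← hNw]; exact mul_le_mul_of_nonneg_right hN2 hN0.le
        _ = K₁ / w := by rw [hK₁]; ring
    have hKp' : 0 ≤ Kp * ((J : ℝ) + 2 + Real.log N) / w := by positivity
    calc _ ≤ (N : ℝ) * N := hcard
      _ ≤ K₁ / w := hNN'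
      _ ≤ K₁ * ((J : ℝ) + 2 + Real.log N) / w := by
          apply div_le_div_of_nonneg_right _ hw.le
          exact le_mul_of_one_le_right hK₁0.le hL1
      _ ≤ (Kp + K₁) * ((J : ℝ) + 2 + Real.log N) / w := by
          have e : (Kp + K₁) * ((J : ℝ) + 2 + Real.log N) / w =
              Kp * ((J : ℝ) + 2 + Real.log N) / w + K₁ * ((J : ℝ) + 2 + Real.log N) / w := by ring
          rw [e]; linarith

end Summit.HubbardSuperconductivity.HubbardSuperconductivity.Theorems.PerturbedFermiCurve

end
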